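import Summits.Ventures.CertifiedArithmetic.LowPrec.GemmThetaE4M3State
import Summits.Ventures.CertifiedArithmetic.LowPrec.GemmGridRoundingWide

/-!
# θ-certificate of E4M3²→bfloat16: structure lemmas of the state graph (soundness, part 1)

HONEST FRAMING (venture CertifiedArithmetic / cell `pub-lowprec`, seat gemm, gen 8): certified error
envelopes and provably optimal rounding/accumulation schemes for low-precision formats under stated
cost models; every table by two implementations; no hardware or vendor claims.

Paper `gemm.tex` §Regimes Prop. Θ(i), instance E4M3·E4M3→`bfloat16`: the letter-independent facts
behind the compressed certificate of `GemmThetaE4M3Defs.lean`, from the kernel-checked tables of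
`GemmThetaE4M3State.lean` and the bridge `GemmGridRoundingWide.lean`: `valG` strictly increasing and
`Φ` nondecreasing (`valG_lt_valG`, `psiZ_sval_mono`, `F_mono`), the absorption windows
(`window_absorbs`: every offset in `[-qlo, qhi]` is absorbed, by the monotonicity of `rne8`) and their
propagation along runs and parity classes (`aLo_le_qlo`).  Part 2 (`GemmThetaE4M3Blocks.lean`) adds the
image lemma and the block structure; part 3 (`GemmThetaE4M3Cover.lean`) derives the per-edge `Facts`
from a passing cover.
-/

namespace Literature.ComputerArithmetic.FloatingPoint

namespace MiniFloat

namespace ThetaE4M3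

/-! ### Sizes -/

/-- Every state magnitude is at most `2^44` grid units (`v ≤ 2^26`). [cell] -/
theorem valG_le (i : ℕ) : valG i ≤ 17592186044416 := by
  unfold valG
  split_ifs with h1 h2
  · omega
  · have he : (i - 256) / 128 + 1 ≤ 36 := by omega
    calc (128 + (i - 256) % 128) * 2 ^ ((i - 256) / 128 + 1) ≤ 255 * 2 ^ 36 :=
          Nat.mul_le_mul (by omega) (Nat.pow_le_pow_right (by norm_num) he)
      _ ≤ 17592186044416 := by norm_num
  · exact le_rfl

/-- `sval true i = -valG i`. [cell] -/
theorem sval_true (i : ℕ) : sval true i = -((valG i : ℕ) : ℤ) := by simp [sval]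

/-- `sval false i = valG i`. [cell] -/
theorem sval_false (i : ℕ) : sval false i = ((valG i : ℕ) : ℤ) := by simp [sval]

/-- `valG i = |sval σ i|` (E4M3 states, grid `2^-18`). [cell] -/
theorem valG_eq_natAbs_sval (σ : Bool) (i : ℕ) : valG i = (sval σ i).natAbs := by
  cases σ
  · rw [sval_false]; simp
  · rw [sval_true]; simp

/-- `|sval σ i| ≤ 2^44`. [cell] -/
theorem natAbs_sval_le (σ : Bool) (i : ℕ) : (sval σ i).natAbs ≤ 17592186044416 :=
  (valG_eq_natAbs_sval σ i).ge.trans (valG_le i)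

/-- Every letter passes `startOK`. [cell certificate] -/
theorem startOK_of_mem {Q : ℤ} (hQ : Q ∈ lamG) : startOK Q = true :=
  List.all_eq_true.mp starts_ok Q hQ

/-- Letters have magnitude at most `52613349376 = 229376²` (`= 448² · 2^18`). [cell] -/
theorem natAbs_le_of_mem_lamG {Q : ℤ} (hQ : Q ∈ lamG) : Q.natAbs ≤ 52613349376 := by
  have h := startOK_of_mem hQ
  unfold startOK at h
  simp only [Bool.and_eq_true, decide_eq_true_eq] at h
  exact h.2

/-- The bridge applies: `|V + Q| < 2^64` whenever both are below `2^45`. [folklore] -/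
theorem natAbs_add_lt64 {V Q : ℤ} (hV : V.natAbs ≤ 35184372088832) (hQ : Q.natAbs ≤ 35184372088832) :
    (V + Q).natAbs < 2 ^ 64 := by
  have : (V + Q).natAbs ≤ V.natAbs + Q.natAbs := Int.natAbs_add_le V Q
  norm_num; omega

/-- `18 ≤ 133`: the grid `2^-18` is within `bfloat16`'s exponent range. [folklore] -/
theorem g18 : (18 : ℕ) ≤ 133 := by norm_num

/-! ### The value/potential chain -/

/-- One link of the chain. [cell certificate] -/
theorem monoChain_at {i : ℕ} (hi : i < 4864) :
    valG i < valG (i + 1) ∧ psiNat (valG i) ≤ psiNat (valG (i + 1)) := by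
  have h := monoChain_ok
  unfold monoChainOK at h
  have h1 := List.all_eq_true.mp h i (List.mem_range.mpr hi)
  simp only [Bool.and_eq_true, decide_eq_true_eq] at h1
  exact h1

/-- `valG` is strictly increasing on `0..4864`. [cell] -/
theorem valG_lt_valG {i j : ℕ} (hij : i < j) (hj : j ≤ 4864) : valG i < valG j := by
  induction j with
  | zero => omega
  | succ j ih =>
    rcases Nat.lt_succ_iff_lt_or_eq.mp hij with h | h
    · exact lt_trans (ih h (by omega)) (monoChain_at (by omega)).1
    · subst h; exact (monoChain_at (by omega)).1

/-- `valG` is monotone on `0..4864`. [cell] -/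
theorem valG_le_valG {i j : ℕ} (hij : i ≤ j) (hj : j ≤ 4864) : valG i ≤ valG j := by
  rcases eq_or_lt_of_le hij with h | h
  · rw [h]
  · exact (valG_lt_valG h hj).le

/-- `valG` is injective on `0..4864`. [cell] -/
theorem valG_inj {i j : ℕ} (hi : i ≤ 4864) (hj : j ≤ 4864) (h : valG i = valG j) : i = j := by
  rcases lt_trichotomy i j with hlt | heq | hgt
  · exact absurd h (ne_of_lt (valG_lt_valG hlt hj))
  · exact heq
  · exact absurd h.symm (ne_of_lt (valG_lt_valG hgt hi))

/-- `Φ` is nondecreasing along the nonnegative states. [cell certificate] -/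
theorem psiNat_valG_mono {i j : ℕ} (hij : i ≤ j) (hj : j ≤ 4864) :
    psiNat (valG i) ≤ psiNat (valG j) := by
  induction j with
  | zero => simp at hij; subst hij; exact le_rfl
  | succ j ih =>
    rcases Nat.lt_succ_iff_lt_or_eq.mp (Nat.lt_succ_iff.mpr hij) with h | h
    · exact le_trans (ih (by omega) (by omega)) (monoChain_at (by omega)).2
    · subst h; exact le_rfl

/-- `Φ ≥ 0` on the nonnegative states. [cell] -/
theorem psiNat_valG_nonneg {i : ℕ} (hi : i ≤ 4864) : 0 ≤ psiNat (valG i) := by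
  have h0 : psiNat (valG 0) = 0 := by decide
  rw [← h0]; exact psiNat_valG_mono (Nat.zero_le i) hi

/-- `Φ(-v) = |v|` on the states. [cell] -/
theorem psiZ_sval_true (i : ℕ) : psiZ (sval true i) = ((valG i : ℕ) : ℤ) := by
  rw [sval_true]; unfold psiZ
  by_cases h : valG i = 0
  · rw [h]; decide
  · rw [if_pos (by omega)]; ring

/-- `Φ(v) = psiNat v` on the nonnegative states. [cell] -/
theorem psiZ_sval_false (i : ℕ) : psiZ (sval false i) = psiNat (valG i) := by
  rw [sval_false]; unfold psiZ; rw [if_neg (by omega), Int.toNat_natCast]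

/-- `Φ` is nondecreasing in the index on each sign. [cell] -/
theorem psiZ_sval_mono (σ : Bool) {i j : ℕ} (hij : i ≤ j) (hj : j ≤ 4864) :
    psiZ (sval σ i) ≤ psiZ (sval σ j) := by
  cases σ
  · rw [psiZ_sval_false, psiZ_sval_false]; exact psiNat_valG_mono hij hj
  · rw [psiZ_sval_true, psiZ_sval_true]; exact_mod_cast valG_le_valG hij hj

/-- `F = Φ + id` IS MONOTONE on the signed states. [cell, gemm.tex §Regimes] -/
theorem F_mono {u w : ℤ} (hu : IsSt u) (hw : IsSt w) (h : u ≤ w) : psiZ u + u ≤ psiZ w + w := by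
  obtain ⟨σ, i, hi, rfl⟩ := hu
  obtain ⟨τ, j, hj, rfl⟩ := hw
  have hpi := psiNat_valG_nonneg hi
  have hpj := psiNat_valG_nonneg hj
  have h0 : psiNat 0 = 0 := by decide
  cases σ <;> cases τ
  · rw [psiZ_sval_false, psiZ_sval_false]
    rw [sval_false, sval_false] at h ⊢
    have hij : i ≤ j := by
      by_contra hc
      have := valG_lt_valG (not_le.mp hc) hi
      omega
    have := psiNat_valG_mono hij hj
    omega
  · rw [psiZ_sval_false, psiZ_sval_true]
    rw [sval_false, sval_true] at h ⊢
    have hi0 : valG i = 0 := by omega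
    rw [hi0, h0]; omega
  · rw [psiZ_sval_true, psiZ_sval_false]
    rw [sval_true, sval_false] at h ⊢
    omega
  · rw [psiZ_sval_true, psiZ_sval_true]
    rw [sval_true, sval_true] at h ⊢
    omega

/-! ### Absorption windows -/

/-- `winCore ≤ h`. [cell] -/
theorem winCore_le (st ev : Bool) (h : ℕ) : winCore st ev h ≤ h := by
  unfold winCore; split_ifs <;> omega

/-- `qlo ≤ 2^36`. [cell] -/
theorem qlo_le (σ : Bool) (i : ℕ) : qlo σ i ≤ 68719476736 := by
  unfold qlo
  by_cases h1 : i < 256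
  · rw [if_pos h1]; omega
  rw [if_neg h1]
  by_cases h2 : 4864 ≤ i
  · rw [if_pos h2]; cases σ <;> simp
  rw [if_neg h2]
  have hb : blk i - 1 ≤ 35 := by
    unfold blk; rw [if_neg h1, if_pos (show i < 4864 by omega)]; omega
  exact (winCore_le _ _ _).trans ((Nat.pow_le_pow_right (show 0 < 2 by norm_num) hb).trans (by norm_num))

/-- `qhi ≤ 2^36`. [cell] -/
theorem qhi_le (σ : Bool) (i : ℕ) : qhi σ i ≤ 68719476736 := by
  unfold qhi
  by_cases h1 : i < 256
  · rw [if_pos h1]; omega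
  rw [if_neg h1]
  by_cases h2 : 4864 ≤ i
  · rw [if_pos h2]; cases σ <;> simp
  rw [if_neg h2]
  have hb : blk i - 1 ≤ 35 := by
    unfold blk; rw [if_neg h1, if_pos (show i < 4864 by omega)]; omega
  exact (winCore_le _ _ _).trans ((Nat.pow_le_pow_right (show 0 < 2 by norm_num) hb).trans (by norm_num))

/-- The two window claims of a state, from the kernel-checked tables. [cell certificate] -/
theorem state_ok (σ : Bool) {i : ℕ} (hi : i ≤ 4864) :
    rne8 (sval σ i - ((qlo σ i : ℕ) : ℤ)) = sval σ i ∧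
      rne8 (sval σ i + ((qhi σ i : ℕ) : ℤ)) = sval σ i := by
  have get : ∀ {a l : ℕ}, statesOK a l = true → a ≤ i → i < a + l → stateOK σ i = true := by
    intro a l h1 h2 h3
    unfold statesOK at h1
    have h4 := List.all_eq_true.mp h1 i (List.mem_range'_1.mpr ⟨h2, h3⟩)
    rw [Bool.and_eq_true] at h4
    cases σ
    · exact h4.1
    · exact h4.2
  have h : stateOK σ i = true := by
    rcases Nat.lt_or_ge i 1200 with h1 | h1
    · exact get states_ok_0 (Nat.zero_le i) (by omega)
    rcases Nat.lt_or_ge i 2400 with h2 | h2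
    · exact get states_ok_1 h1 (by omega)
    rcases Nat.lt_or_ge i 3600 with h3 | h3
    · exact get states_ok_2 h2 (by omega)
    · exact get states_ok_3 h3 (by omega)
  unfold stateOK at h
  simp only [Bool.and_eq_true, decide_eq_true_eq] at h
  exact h

/-- THE WINDOW LEMMA: every integer offset `Z ∈ [-qlo, qhi]` is absorbed at the state — `rne8` is
monotone and the two ends are absorbed. [cell, gemm.tex §Regimes] -/
theorem window_absorbs (σ : Bool) {i : ℕ} (hi : i ≤ 4864) {Z : ℤ}
    (h1 : -((qlo σ i : ℕ) : ℤ) ≤ Z) (h2 : Z ≤ ((qhi σ i : ℕ) : ℤ)) :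
    rne8 (sval σ i + Z) = sval σ i := by
  obtain ⟨hlo, hhi⟩ := state_ok σ hi
  have hV := natAbs_sval_le σ i
  have hq1 := qlo_le σ i
  have hq2 := qhi_le σ i
  have b1 : (sval σ i - ((qlo σ i : ℕ) : ℤ)).natAbs < 2 ^ 64 := by omega
  have b2 : (sval σ i + Z).natAbs < 2 ^ 64 := by omega
  have b3 : (sval σ i + ((qhi σ i : ℕ) : ℤ)).natAbs < 2 ^ 64 := by omega
  have m1 := rne8_mono b1 b2 (by omega)
  have m2 := rne8_mono b2 b3 (by omega)
  rw [hlo] at m1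
  rw [hhi] at m2
  exact le_antisymm m2 m1

/-- A state is a `bfloat16` rounding (of itself minus its window). [cell] -/
theorem sval_eq_rne8 (σ : Bool) {i : ℕ} (hi : i ≤ 4864) :
    rne8 (sval σ i - ((qlo σ i : ℕ) : ℤ)) = sval σ i := (state_ok σ hi).1

/-- A letter that moves a state lies outside its window: `min(qlo, qhi) + 1 ≤ |Z|`. [cell] -/
theorem moved_outside_window (σ : Bool) {j : ℕ} (hj : j ≤ 4864) {Z : ℤ}
    (hne : rne8 (sval σ j + Z) ≠ sval σ j) :
    ((min (qlo σ j) (qhi σ j) : ℕ) : ℤ) + 1 ≤ (Z.natAbs : ℤ) := by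
  by_contra hc
  have hm1 := min_le_left (qlo σ j) (qhi σ j)
  have hm2 := min_le_right (qlo σ j) (qhi σ j)
  exact hne (window_absorbs σ hj (by omega) (by omega))

/-- One link of the window chains. [cell certificate] -/
theorem winChain_at {p i : ℕ} (hp : p = 1 ∨ p = 2) (hi : i < 4865) (σ : Bool) :
    mlo σ p i ≤ mlo σ p (i + p) ∧ mhi σ p i ≤ mhi σ p (i + p) := by
  have h : winChainOK p 4865 = true := by
    rcases hp with rfl | rfl
    · exact winChain_one
    · exact winChain_two
  unfold winChainOK at h
  have h1 := List.all_eq_true.mp h i (List.mem_range.mpr hi)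
  simp only [Bool.and_eq_true, decide_eq_true_eq] at h1
  cases σ
  · exact ⟨h1.1.1.1, h1.1.2⟩
  · exact ⟨h1.1.1.2, h1.2⟩

/-- The window chains, iterated. [cell] -/
theorem mlo_mhi_chain (σ : Bool) {p : ℕ} (hp : p = 1 ∨ p = 2) (i : ℕ) :
    ∀ m : ℕ, i + p * m ≤ 4864 + p →
      mlo σ p i ≤ mlo σ p (i + p * m) ∧ mhi σ p i ≤ mhi σ p (i + p * m)
  | 0, _ => by simp
  | m + 1, h => by
      rw [Nat.mul_succ] at h
      obtain ⟨ih1, ih2⟩ := mlo_mhi_chain σ hp i m (by omega)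
      obtain ⟨c1, c2⟩ := winChain_at hp (show i + p * m < 4865 by omega) σ
      rw [Nat.mul_succ, ← Nat.add_assoc]
      exact ⟨ih1.trans c1, ih2.trans c2⟩

/-- THE RUN/CLASS WINDOW BOUND: `aLo σ j₁ j₂ p` (`aHi`) bounds the window of every member
`j₁ + p·m ≤ j₂` from below. [cell] -/
theorem aLo_le_qlo (σ : Bool) {p : ℕ} (hp : p = 1 ∨ p = 2) {j₁ j₂ : ℕ} (hj : j₂ ≤ 4864) (m : ℕ)
    (hm : j₁ + p * m ≤ j₂) :
    aLo σ j₁ j₂ p ≤ qlo σ (j₁ + p * m) ∧ aHi σ j₁ j₂ p ≤ qhi σ (j₁ + p * m) := by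
  unfold aLo aHi
  rcases Nat.eq_zero_or_pos m with rfl | hm0
  · simp only [Nat.mul_zero, Nat.add_zero]
    constructor <;> (split_ifs <;> first | exact le_rfl | exact min_le_left _ _)
  · have hpm : p ≤ p * m := Nat.le_mul_of_pos_right p hm0
    have hge : ¬ j₂ < j₁ + p := by omega
    rw [if_neg hge, if_neg hge]
    have e : p * (m - 1) + p = p * m := by
      rcases hp with rfl | rfl <;> omega
    obtain ⟨c1, c2⟩ := mlo_mhi_chain σ hp j₁ (m - 1) (by omega)
    unfold mlo at c1
    unfold mhi at c2
    rw [Nat.add_assoc, e] at c1 c2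
    exact ⟨c1.trans (min_le_right _ _), c2.trans (min_le_right _ _)⟩

end ThetaE4M3

end MiniFloat

end Literature.ComputerArithmetic.FloatingPoint
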